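import Mathlib
import HarnessLib
import Summits.Ventures.LatticeQCDFlow.Exactness.SU2KickCalculus
import Summits.Ventures.LatticeQCDFlow.Exactness.SU2KickJacobian
import Summits.Ventures.LatticeQCDFlow.Exactness.SU2MultiStepLeapfrogHMC

/-!
# The quaternion retraction `W ↦ gaussUnit (vecQuat W)` of `M₂(ℂ)` onto `SU(2)`: a `C^∞` extension device for functions of `SU(2)` lattice gauge fields; the Pauli drift through it; `C¹` near a compact set is Lipschitz

HONEST FRAMING: exact (Metropolis-corrected) sampling algorithms for lattice gauge theory;
figures of merit are autocorrelation/cost numbers at stated couplings and volumes; no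
continuum-physics claim.

Venture `LatticeQCDFlow` (cell pub-lqcd), topic `Exactness`; FANOUT row 14 (`eng-flowhmc`; the
multi-step convergence theorem of row 9's `SU(2)` kernel asks of a force FIELD on `SU(2)^links` that it
be bounded per link and Lipschitz in the AMBIENT matrix sup norm `‖coeConfig V − coeConfig V'‖`).  NEW
WORK of the cell over Mathlib and the tree (`HaarSU2Gaussian`: `quatVec`, `vecQuat`, `gaussUnit`;
`SU2KickJacobian.gaussUnit_vecQuat`; `SU2MultiStepLeapfrogHMC.pauliCoordι`; the Literature's `expPauli`;
`MatrixExpChart.contDiffAt_matrixExp`; `SUNProductTrajectory.coeConfig`); nothing is cited as a fact; no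
number.  THE DEVICE.  A smooth function of the LINKS read as matrices is not automatically a smooth
function on the ambient algebra `links → M₂(ℂ)`; but `r(W) = gaussUnit (vecQuat W)` (normalise the
quaternion part of `W`) is a retraction `M₂(ℂ) → SU(2)` (`r(U) = U` on `SU(2)`), `C^∞` on the open set
`{vecQuat W ≠ 0} ⊇ SU(2)`, so `f ∘ r` extends any `f` given along smooth `SU(2)`-valued fields to an
honest `C^n` function near the compact set of configurations — where `C¹` means Lipschitz.

* §1 `contDiff_vecQuat`, `contDiff_quatVec`, `contDiff_conjTranspose_two`, `contDiff_matrixExp`,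
  `contDiff_expPauli_coe` (`A ↦ exp(iA·σ)` as a matrix-valued map of `A ∈ ℝ³`);
* §2 **`contDiffAt_gaussUnit_vecQuat`** (the retraction is `C^n` at every `W` with `vecQuat W ≠ 0`),
  **`contDiffAt_pauliRetractionField_link`** (the field `(W, a) ↦ (l ↦ expPauli (a l) · r(W l))` is
  link-`C^n` at every `(W, a)` with all `vecQuat (W l) ≠ 0`), **`pauliRetractionField_coeConfig`** (at
  `W = coeConfig V` it IS the kernel's drift `(l ↦ expPauli (a l)) * V`);
* §3 `isOpen_retractable`, `coeConfig_mem_retractable`, `continuous_coeConfig_su2`,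
  `isCompact_range_coeConfig_su2`;
* §4 **`exists_lipschitzOnWith_of_contDiffOn`** — a map `C¹` on an open neighbourhood of a compact
  set of a finite-dimensional real normed space is Lipschitz on that set (mean value inequality on small
  balls of a compact thickening + a crude bound at large distance; the constant exists, none is computed),
  `exists_bound_of_continuousOn_compact` (restated convenience).

NOT CLAIMED: any constant; anything about `SU(N ≥ 3)` (no quaternion retraction there; a polar
retraction would be needed); any number.
-/

noncomputable section

namespace Summit.Ventures.LatticeQCDFlow.Exactness

open Set Filter Topology Metric Function NormedSpace
open Literature.MathematicalPhysics.QuantumFieldTheory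
open Literature.MathematicalPhysics.QuantumFieldTheory.Balaban1983to89.B10Eq18SigmaSU2 (su2Coord)
open Literature.MathematicalPhysics.QuantumFieldTheory.Balaban1983to89.B10Eq18SigmaSU2Haar (expPauli coe_expPauli)
open scoped Matrix Matrix.Norms.Operator NNReal

set_option backward.isDefEq.respectTransparency false

/-! ## §1 Linear and exponential pieces are `C^n` -/

section Linear

variable {n : WithTop ℕ∞}

/-- `vecQuat` is `C^n` (it is `ℝ`-linear). -/
theorem contDiff_vecQuat : ContDiff ℝ n (vecQuat : Matrix (Fin 2) (Fin 2) ℂ → R4) := by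
  let Lv : Matrix (Fin 2) (Fin 2) ℂ →ₗ[ℝ] R4 :=
    { toFun := vecQuat,
      map_add' := vecQuat_add,
      map_smul' := fun r M => by rw [RingHom.id_apply, ← vecQuat_smul, coe_real_smul_matrix] }
  exact (LinearMap.toContinuousLinearMap Lv).contDiff

/-- `quatVec` is `C^n` (it is `ℝ`-linear). -/
theorem contDiff_quatVec : ContDiff ℝ n (quatVec : R4 → Matrix (Fin 2) (Fin 2) ℂ) := by
  let Lq : R4 →ₗ[ℝ] Matrix (Fin 2) (Fin 2) ℂ :=
    { toFun := quatVec,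
      map_add' := quatVec_add,
      map_smul' := fun r x => by rw [RingHom.id_apply, quatVec_smul, coe_real_smul_matrix] }
  exact (LinearMap.toContinuousLinearMap Lq).contDiff

/-- Conjugate transposition of `2 × 2` complex matrices is `C^n` (`ℝ`-linear). -/
theorem contDiff_conjTranspose_two : ContDiff ℝ n (fun W : Matrix (Fin 2) (Fin 2) ℂ => Wᴴ) := by
  let CT : Matrix (Fin 2) (Fin 2) ℂ →ₗ[ℝ] Matrix (Fin 2) (Fin 2) ℂ :=
    { toFun := fun W => Wᴴ,
      map_add' := fun A B => Matrix.conjTranspose_add A B,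
      map_smul' := fun r A => by rw [Matrix.conjTranspose_smul, RingHom.id_apply, star_trivial] }
  exact (LinearMap.toContinuousLinearMap CT).contDiff

/-- The matrix exponential is `C^n` on `M_k(ℂ)` for every `n`. -/
theorem contDiff_matrixExp {k : Type*} [Fintype k] [DecidableEq k] :
    ContDiff ℝ n (exp : Matrix k k ℂ → Matrix k k ℂ) :=
  contDiff_iff_contDiffAt.2 fun X => (contDiffAt_matrixExp X).of_le le_top

/-- `A ↦ exp(iA·σ)` (the Literature's `expPauli`, read as a matrix) is `C^n` on `ℝ³`. -/
theorem contDiff_expPauli_coe :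
    ContDiff ℝ n (fun A : EuclideanSpace ℝ (Fin 3) => ((expPauli A : Matrix.specialUnitaryGroup (Fin 2) ℂ) : Matrix (Fin 2) (Fin 2) ℂ)) := by
  have h : (fun A : EuclideanSpace ℝ (Fin 3) => ((expPauli A : Matrix.specialUnitaryGroup (Fin 2) ℂ) : Matrix (Fin 2) (Fin 2) ℂ)) =
      fun A => exp (pauliCoordι A) := by
    funext A; rfl
  rw [h]
  exact contDiff_matrixExp.comp (LinearMap.toContinuousLinearMap pauliCoordι).contDiff

end Linear

/-! ## §2 The retraction and the Pauli drift through it -/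

section Retraction

variable {n : WithTop ℕ∞}

/-- **The quaternion retraction `W ↦ gaussUnit (vecQuat W)` is `C^n` at every `W` with
`vecQuat W ≠ 0`** (there it is `quatVec (vecQuat W / ‖vecQuat W‖)`). -/
theorem contDiffAt_gaussUnit_vecQuat {W₀ : Matrix (Fin 2) (Fin 2) ℂ} (hW : vecQuat W₀ ≠ 0) :
    ContDiffAt ℝ n (fun W : Matrix (Fin 2) (Fin 2) ℂ =>
      ((gaussUnit (vecQuat W) : Matrix.specialUnitaryGroup (Fin 2) ℂ) : Matrix (Fin 2) (Fin 2) ℂ)) W₀ := by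
  have hev : ∀ᶠ W in 𝓝 W₀, vecQuat W ≠ 0 :=
    (contDiff_vecQuat (n := n)).continuous.continuousAt.eventually_ne hW
  have heq : (fun W : Matrix (Fin 2) (Fin 2) ℂ => quatVec (‖vecQuat W‖⁻¹ • vecQuat W)) =ᶠ[𝓝 W₀]
      (fun W : Matrix (Fin 2) (Fin 2) ℂ => ((gaussUnit (vecQuat W) : Matrix.specialUnitaryGroup (Fin 2) ℂ) : Matrix (Fin 2) (Fin 2) ℂ)) := by
    filter_upwards [hev] with W hW'
    rw [coe_gaussUnit_of_ne_zero hW']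
  refine ContDiffAt.congr_of_eventuallyEq ?_ heq.symm
  have hv : ContDiffAt ℝ n (vecQuat : Matrix (Fin 2) (Fin 2) ℂ → R4) W₀ := contDiff_vecQuat.contDiffAt
  have hnorm : ContDiffAt ℝ n (fun W : Matrix (Fin 2) (Fin 2) ℂ => ‖vecQuat W‖) W₀ := hv.norm ℝ hW
  exact contDiff_quatVec.contDiffAt.comp W₀ ((hnorm.inv (norm_ne_zero_iff.2 hW)).smul hv)

variable {ι : Type*} [Fintype ι]

/-- **The Pauli drift through the retraction is link-`C^n`**: for every link `l` and every
`(W, a)` with `vecQuat (W l) ≠ 0`, the matrix of link `l` of `(l ↦ expPauli (a l)) * (l ↦ r(W l))` is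
a `C^n` function of `(W, a) ∈ (links → M₂(ℂ)) × (links → ℝ³)`. -/
theorem contDiffAt_pauliRetractionField_link (l : ι)
    {z₀ : (ι → Matrix (Fin 2) (Fin 2) ℂ) × (ι → EuclideanSpace ℝ (Fin 3))} (hz : vecQuat (z₀.1 l) ≠ 0) :
    ContDiffAt ℝ n (fun z : (ι → Matrix (Fin 2) (Fin 2) ℂ) × (ι → EuclideanSpace ℝ (Fin 3)) =>
      ((((fun l : ι => expPauli (z.2 l)) * (fun l : ι => gaussUnit (vecQuat (z.1 l)))) l :
        Matrix.specialUnitaryGroup (Fin 2) ℂ) : Matrix (Fin 2) (Fin 2) ℂ)) z₀ := by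
  simp only [Pi.mul_apply, WilsonFlow.coe_mul_SU]
  have h1 : ContDiffAt ℝ n (fun z : (ι → Matrix (Fin 2) (Fin 2) ℂ) × (ι → EuclideanSpace ℝ (Fin 3)) =>
      ((expPauli (z.2 l) : Matrix.specialUnitaryGroup (Fin 2) ℂ) : Matrix (Fin 2) (Fin 2) ℂ)) z₀ :=
    (contDiff_expPauli_coe.comp ((contDiff_apply ℝ _ l).comp contDiff_snd)).contDiffAt
  have hproj : ContDiffAt ℝ n (fun z : (ι → Matrix (Fin 2) (Fin 2) ℂ) × (ι → EuclideanSpace ℝ (Fin 3)) => z.1 l) z₀ :=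
    ((contDiff_apply ℝ (Matrix (Fin 2) (Fin 2) ℂ) l).comp contDiff_fst).contDiffAt
  have h2 : ContDiffAt ℝ n ((fun W : Matrix (Fin 2) (Fin 2) ℂ =>
      ((gaussUnit (vecQuat W) : Matrix.specialUnitaryGroup (Fin 2) ℂ) : Matrix (Fin 2) (Fin 2) ℂ)) ∘
      (fun z : (ι → Matrix (Fin 2) (Fin 2) ℂ) × (ι → EuclideanSpace ℝ (Fin 3)) => z.1 l)) z₀ :=
    (contDiffAt_gaussUnit_vecQuat hz).comp z₀ hproj
  exact h1.mul h2

omit [Fintype ι] in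
/-- **On configurations the retraction field IS the kernel's drift**:
`(l ↦ expPauli (a l)) * (l ↦ r((V l : M₂(ℂ)))) = (l ↦ expPauli (a l)) * V`. -/
theorem pauliRetractionField_coeConfig (V : ι → Matrix.specialUnitaryGroup (Fin 2) ℂ) (a : ι → EuclideanSpace ℝ (Fin 3)) :
    (fun l : ι => expPauli (a l)) * (fun l : ι => gaussUnit (vecQuat (coeConfig V l))) =
      (fun l : ι => expPauli (a l)) * V := by
  funext l
  rw [Pi.mul_apply, Pi.mul_apply, coeConfig_apply, gaussUnit_vecQuat]

omit [Fintype ι] in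
/-- The retraction of a configuration read as matrices is the configuration. -/
theorem retraction_coeConfig (V : ι → Matrix.specialUnitaryGroup (Fin 2) ℂ) :
    (fun l : ι => gaussUnit (vecQuat (coeConfig V l))) = V := by
  funext l
  rw [coeConfig_apply, gaussUnit_vecQuat]

end Retraction

/-! ## §3 Topology: the retractable set is open and contains the compact set of configurations -/

section Topology

variable {ι : Type*} [Fintype ι]

/-- The set of ambient fields with every link retractable is open. -/
theorem isOpen_retractable :
    IsOpen {W : ι → Matrix (Fin 2) (Fin 2) ℂ | ∀ l, vecQuat (W l) ≠ 0} := by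
  have h : {W : ι → Matrix (Fin 2) (Fin 2) ℂ | ∀ l, vecQuat (W l) ≠ 0} =
      ⋂ l : ι, (fun W : ι → Matrix (Fin 2) (Fin 2) ℂ => vecQuat (W l)) ⁻¹' {(0 : R4)}ᶜ := by
    ext W; simp
  rw [h]
  exact isOpen_iInter_of_finite fun l =>
    isOpen_compl_singleton.preimage ((contDiff_vecQuat (n := 0)).continuous.comp (continuous_apply l))

omit [Fintype ι] in
/-- Configurations are retractable. -/
theorem coeConfig_mem_retractable (V : ι → Matrix.specialUnitaryGroup (Fin 2) ℂ) :
    coeConfig V ∈ {W : ι → Matrix (Fin 2) (Fin 2) ℂ | ∀ l, vecQuat (W l) ≠ 0} :=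
  fun l => by rw [coeConfig_apply]; exact vecQuat_ne_zero_of_mem (V l)

omit [Fintype ι] in
/-- `coeConfig` is continuous. -/
theorem continuous_coeConfig_su2 :
    Continuous (coeConfig : (ι → Matrix.specialUnitaryGroup (Fin 2) ℂ) → ι → Matrix (Fin 2) (Fin 2) ℂ) :=
  continuous_pi fun l => continuous_subtype_val.comp (continuous_apply l)

omit [Fintype ι] in
/-- The configurations read as matrices form a compact set. -/
theorem isCompact_range_coeConfig_su2 :
    IsCompact (range (coeConfig : (ι → Matrix.specialUnitaryGroup (Fin 2) ℂ) → ι → Matrix (Fin 2) (Fin 2) ℂ)) :=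
  isCompact_range continuous_coeConfig_su2

/-- The matrix sup distance of two configurations is `‖coeConfig V − coeConfig V'‖`. -/
theorem dist_coeConfig (V V' : ι → Matrix.specialUnitaryGroup (Fin 2) ℂ) :
    dist (coeConfig V) (coeConfig V') = ‖coeConfig V - coeConfig V'‖ := dist_eq_norm _ _

end Topology

/-! ## §4 `C¹` on an open neighbourhood of a compact set is Lipschitz on the set -/

section Lipschitz

variable {E F : Type*} [NormedAddCommGroup E] [NormedSpace ℝ E] [FiniteDimensional ℝ E]
  [NormedAddCommGroup F] [NormedSpace ℝ F]

omit [NormedSpace ℝ E] [FiniteDimensional ℝ E] [NormedSpace ℝ F] in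
/-- A continuous function is bounded on a compact set (restated for convenience). -/
theorem exists_bound_of_continuousOn_compact {f : E → F} {K : Set E} (hK : IsCompact K) (hf : ContinuousOn f K) :
    ∃ B : ℝ, 0 ≤ B ∧ ∀ x ∈ K, ‖f x‖ ≤ B := by
  obtain ⟨B, hB⟩ := hK.exists_bound_of_continuousOn hf
  exact ⟨max B 0, le_max_right _ _, fun x hx => (hB x hx).trans (le_max_left _ _)⟩

/-- **A map `C¹` on an open neighbourhood `O` of a compact set `K` (finite-dimensional real source) is
Lipschitz on `K`.**  Pairs at distance `≤ δ` (a thickening radius with `cthickening δ K ⊆ O`) are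
joined by a segment inside a ball of the compact thickening, where `‖Df‖ ≤ M` (mean value
inequality); pairs farther apart are handled by `2 sup_K ‖f‖ / δ`.  No constant is computed. -/
theorem exists_lipschitzOnWith_of_contDiffOn {f : E → F} {O K : Set E} (hO : IsOpen O) (hK : IsCompact K)
    (hKO : K ⊆ O) (hf : ContDiffOn ℝ 1 f O) : ∃ C : ℝ≥0, LipschitzOnWith C f K := by
  -- a compact thickening inside `O`
  obtain ⟨δ, hδ, hthick⟩ := hK.exists_cthickening_subset_open hO hKO
  have hK' : IsCompact (cthickening δ K) := hK.cthickening
  -- bound on the derivative on the thickening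
  have hcont : ContinuousOn (fun x => fderiv ℝ f x) (cthickening δ K) :=
    (hf.continuousOn_fderiv_of_isOpen hO le_rfl).mono hthick
  obtain ⟨M, hM0, hM⟩ := exists_bound_of_continuousOn_compact hK' hcont
  -- bound on the function on `K`
  obtain ⟨B, hB0, hB⟩ := exists_bound_of_continuousOn_compact hK (hf.continuousOn.mono hKO)
  have hdiff : ∀ x ∈ O, DifferentiableAt ℝ f x := fun x hx =>
    (hf.differentiableOn one_ne_zero x hx).differentiableAt (hO.mem_nhds hx)
  refine ⟨Real.toNNReal (max M (2 * B / δ)), LipschitzOnWith.of_dist_le_mul fun x hx y hy => ?_⟩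
  rw [Real.coe_toNNReal _ (hM0.trans (le_max_left _ _)), dist_eq_norm, dist_eq_norm]
  by_cases hxy : ‖x - y‖ ≤ δ
  · -- close pairs: mean value inequality on the closed ball around `y`
    have hball : closedBall y δ ⊆ cthickening δ K := closedBall_subset_cthickening hy δ
    have hx' : x ∈ closedBall y δ := by rw [mem_closedBall, dist_eq_norm]; exact hxy
    have hmv : ‖f x - f y‖ ≤ M * ‖x - y‖ :=
      (convex_closedBall y δ).norm_image_sub_le_of_norm_fderiv_le
        (fun z hz => hdiff z (hthick (hball hz))) (fun z hz => hM z (hball hz)) (mem_closedBall_self hδ.le) hx'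
    exact hmv.trans (mul_le_mul_of_nonneg_right (le_max_left _ _) (norm_nonneg _))
  · -- far pairs: crude bound
    have hxy' : δ < ‖x - y‖ := not_le.mp hxy
    have h1 : ‖f x - f y‖ ≤ 2 * B := by
      calc ‖f x - f y‖ ≤ ‖f x‖ + ‖f y‖ := norm_sub_le _ _
        _ ≤ B + B := add_le_add (hB x hx) (hB y hy)
        _ = 2 * B := by ring
    have h2 : 2 * B ≤ 2 * B / δ * ‖x - y‖ := by
      rw [div_mul_eq_mul_div, le_div_iff₀ hδ]
      exact mul_le_mul_of_nonneg_left hxy'.le (by positivity)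
    exact h1.trans (h2.trans (mul_le_mul_of_nonneg_right (le_max_right _ _) (norm_nonneg _)))

end Lipschitz

end Summit.Ventures.LatticeQCDFlow.Exactness
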